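import Summits.AtomisticToContinuum.BoseEinsteinCondensation.Theorems.BECGroundStateSOSLatticeODLROOffHalfFillingOfConcave
import Summits.AtomisticToContinuum.BoseEinsteinCondensation.Theorems.BECGroundStateSOSLatticeODLROOffHalfFillingGroundSectorUnique

/-!
# Crux `LatticeODLROOffHalfFilling` — the LADDER line, gen-1 skeleton (K1 = MONO), synced to the tree (lead c1, 16:40Z)

Line `Sketch` of crux `stmt-AtomisticToContinuum-11033` (route BECGroundStateSOS). Everything except K1 is LANDED:

* ladder infrastructure (lead -0): `stub_tent` p86193, `stub_average` p87492, `stub_anchor` p87584, `stub_sectorGround`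
  p87638, `stub_kineticBound` p87898, `stub_trialEnergy` p88343, glue `…LadderGlue` p89623 (`col_facts`, `sector_window`),
  reductions `…OfConcave` p90040 (`LatticeODLROOffHalfFilling_of_comparable`, `_of_concave`);
* the half-filled anchor GroundSectorUnique (gen-1 lead, seat -1): `stub_twistTraceNonneg` p97513,
  `stub_twistNonneg_of_trace` p99055, `stub_groundSector_of_twist` p100572 (+ lemmas p98896), assembled as
  `groundSector_zero` in `…GroundSectorUnique` p102839; and the Casimir-shape reduction `…OfCasimir` p104563
  (`LatticeODLROOffHalfFilling_of_casimir`, modulo Casimir monotonicity and `klsRiemannSum 3 L ≤ ½` eventually).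

The ONE remaining `sorry` is K1 itself, `stub_mono` ("half filling is the least coherent filling"). Verdict of both gen-1
leads: crux-sized — with the anchor it is planar LRO at every filling, it is not a universal inequality (zoo kit j016263:
fails on the prism C₃□K₂, K_{a,b}, stars and every irregular graph; holds on all bipartite tori computed) and on tori it is
decided by quantum corrections only (mean-field degenerate). See `Cruxes/LatticeODLROOffHalfFilling/NOTES.md` §B–E.
Composition `LatticeODLROOffHalfFilling_of` (gen-1 planner, unchanged): `μ₀ = ½`, liminf bound `8a₀/25`.
-/

noncomputable section

namespace Summit.AtomisticToContinuum.BoseEinsteinCondensation.Theorems.LatticeODLROOffHalfFilling.Ladder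

open Literature.MathematicalPhysics.QuantumLattice Literature.Probability.LatticeModels Matrix Finset
open Summit.AtomisticToContinuum.BoseEinsteinCondensation.Theorems.LatticeODLROOffHalfFilling.Negative
open scoped ComplexOrder BigOperators Kronecker

/-! ### K1 (MONO) — the conjecture of the line -/

/-- **K1 (MONO), the conjecture of the line.** On every large even torus `(ℤ/Lℤ)³`, for every filling
`1 ≤ N ≤ L³ − 1`, the coherence of the sector ground vector `ψ` with `N` particles dominates the coherence at half
filling scaled by the mean-field profile: `(a(ψh) − L³/2) · 4N(L³−N)/L⁶ ≤ a(ψ) − L³/2`, `a(φ) = Re⟨φ, Oφ⟩/‖φ‖²`,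
`O = Σ_{x,y}(S¹_xS¹_y+S²_xS²_y)`, `ψh` the half-filled sector ground vector ("half filling is the least coherent
filling", `B_L(N) ≥ B_L(L³/2)`). [conjecture; ED: true on every cluster computed (≤ 64 sites), false on the star
`K_{1,m}`; crux-sized — it asserts order at fillings `≠ ½`] -/
theorem stub_mono :
    ∃ L₀ : ℕ, ∀ (L : ℕ) [NeZero L], L₀ ≤ L → Even L → ∀ N : ℕ, 1 ≤ N → N + 1 ≤ L ^ 3 →
    ∀ ψ ψh : TensorIndex (TorusSite 3 L) 2 → ℂ,
      ψ ≠ 0 → (totalSpin 1 2 : Op (TorusSite 3 L) 2) *ᵥ ψ =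
          ((((N : ℝ) - (L : ℝ) ^ 3 / 2 : ℝ)) : ℂ) • ψ →
        xyTorus 3 L 1 *ᵥ ψ = ((lowestEnergyInSector 1 (xyTorus 3 L 1)
          ((N : ℝ) - (L : ℝ) ^ 3 / 2) : ℝ) : ℂ) • ψ →
      ψh ≠ 0 → (totalSpin 1 2 : Op (TorusSite 3 L) 2) *ᵥ ψh = ((0 : ℝ) : ℂ) • ψh →
        xyTorus 3 L 1 *ᵥ ψh = ((lowestEnergyInSector 1 (xyTorus 3 L 1) 0 : ℝ) : ℂ) • ψh →
      ((star ψh ⬝ᵥ (∑ x : TorusSite 3 L, ∑ y : TorusSite 3 L, hop x y) *ᵥ ψh).re /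
            (star ψh ⬝ᵥ ψh).re - (L : ℝ) ^ 3 / 2) *
          (4 * (N : ℝ) * ((L : ℝ) ^ 3 - N) / ((L : ℝ) ^ 3) ^ 2) ≤
        (star ψ ⬝ᵥ (∑ x : TorusSite 3 L, ∑ y : TorusSite 3 L, hop x y) *ᵥ ψ).re /
            (star ψ ⬝ᵥ ψ).re - (L : ℝ) ^ 3 / 2 := by
  sorry

/-! ### The composition: MONO + GroundSectorUnique ⇒ the crux -/

/-- **The ladder line closes the crux modulo K1 = MONO** (`μ₀ = ½`, liminf bound `8a₀/25`). [folklore] -/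
theorem LatticeODLROOffHalfFilling_of :
    Summit.AtomisticToContinuum.BoseEinsteinCondensation.Theses.BECGroundStateSOS.LatticeODLROOffHalfFilling := by
  rw [latticeODLRO_iff]
  obtain ⟨L₁, hmono⟩ := stub_mono
  obtain ⟨a₀, ha₀, k₀, hanchor⟩ := stub_anchor
  refine ⟨1 / 2, by norm_num, fun μ hμ => ?_⟩
  have hμ' : |μ| ≤ 1 / 2 := hμ.le
  unfold LROAt
  set f : ℕ → ℝ := fun k : ℕ => (∑ x ∈ halfOpenBox 3 (2 * k), ∑ y ∈ halfOpenBox 3 (2 * k),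
    torusPullback (d := 3) (fun L x y => if hL : L = 0 then 0 else (haveI : NeZero L := ⟨hL⟩;
      (∑ α : Fin 2, (xxzHamiltonian 1 (torusGraph 3 L) (-1) 0 -
        (μ : ℂ) • totalSpin 1 2).groundStateFunctional
        (siteSpin 1 x (Fin.castSucc α) * siteSpin 1 y (Fin.castSucc α))).re)) (2 * k) x y) /
      ((halfOpenBox 3 (2 * k)).card : ℝ) ^ 2 with hf
  have hbd : ∀ k, f k ≤ 1 / 2 := fun k => orderParam_le_half μ k
  set c' : ℝ := 8 * a₀ / 25 with hc'
  have hc'pos : 0 < c' := by positivity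
  suffices hev : ∀ᶠ k : ℕ in Filter.atTop, c' ≤ f k from
    hc'pos.trans_le (Filter.le_liminf_of_le (Filter.isCoboundedUnder_ge_of_le Filter.atTop hbd) hev)
  -- `N₀` with `a₀ V² ≥ V` for `V ≥ N₀` (so that `a₀V² − V/2 ≥ a₀V²/2`)
  obtain ⟨N₀, hN₀⟩ := exists_nat_gt (1 / a₀)
  filter_upwards [Filter.eventually_ge_atTop (max k₀ (max 2 (max L₁ N₀)))] with k hk
  have hk₀ : k₀ ≤ k := le_trans (le_max_left _ _) hk
  have hk2 : 2 ≤ k := le_trans (le_trans (le_max_left _ _) (le_max_right _ _)) hk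
  have hkL₁ : L₁ ≤ 2 * k :=
    (le_trans (le_trans (le_trans (le_max_left _ _) (le_max_right _ _)) (le_max_right _ _)) hk).trans
      (by omega)
  have hkN₀ : N₀ ≤ 2 * k :=
    (le_trans (le_trans (le_trans (le_max_right _ _) (le_max_right _ _)) (le_max_right _ _)) hk).trans
      (by omega)
  have hL0 : 2 * k ≠ 0 := by omega
  haveI : NeZero (2 * k) := ⟨hL0⟩
  have hL3 : 3 ≤ 2 * k := by omega
  have hL4 : 4 ≤ 2 * k := by omega
  have hEven : Even (2 * k) := even_two_mul k
  -- notation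
  set L : ℕ := 2 * k with hLdef
  set V : ℝ := (L : ℝ) ^ 3 with hVdef
  have hVpos : 0 < V := by positivity
  have hV1 : (1 : ℝ) / a₀ < V := by
    have h1 : (N₀ : ℝ) ≤ (L : ℝ) := by exact_mod_cast hkN₀
    have hL1 : (1 : ℝ) ≤ (L : ℝ) := by
      have : (1 : ℕ) ≤ L := by omega
      exact_mod_cast this
    have h2 : (L : ℝ) ≤ V := by
      rw [hVdef]
      have hL0' : (0 : ℝ) ≤ (L : ℝ) := by positivity
      calc (L : ℝ) = L * 1 * 1 := by ring
        _ ≤ L * L * L := by gcongr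
        _ = (L : ℝ) ^ 3 := by ring
    linarith
  have haV : V ≤ a₀ * V ^ 2 := by
    rw [div_lt_iff₀ ha₀] at hV1
    nlinarith
  set O : Op (TorusSite 3 L) 2 := ∑ x : TorusSite 3 L, ∑ y : TorusSite 3 L, hop x y with hO
  -- columns of `P₀(H_{L,μ'})`, `|μ'| ≤ ½`: sector ground vectors in a sector of the window
  have hcol : ∀ μ' : ℝ, |μ'| ≤ 1 / 2 → ∀ σ : TensorIndex (TorusSite 3 L) 2,
      (Hmu L μ').groundProj.col σ ≠ 0 →
      ∃ N : ℕ, V / 5 ≤ (N : ℝ) ∧ (N : ℝ) ≤ 4 / 5 * V ∧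
        (totalSpin 1 2 : Op (TorusSite 3 L) 2) *ᵥ (Hmu L μ').groundProj.col σ =
          (((((N : ℕ) : ℝ) - (L : ℝ) ^ 3 / 2 : ℝ)) : ℂ) • (Hmu L μ').groundProj.col σ ∧
        xyTorus 3 L 1 *ᵥ (Hmu L μ').groundProj.col σ = ((lowestEnergyInSector 1 (xyTorus 3 L 1)
          (((N : ℕ) : ℝ) - (L : ℝ) ^ 3 / 2) : ℝ) : ℂ) • (Hmu L μ').groundProj.col σ := by
    intro μ' hμ'abs σ hv0
    set v := (Hmu L μ').groundProj.col σ with hvdef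
    obtain ⟨hvmem, hS3⟩ := col_facts L hL3 μ' σ
    set M : ℝ := (L : ℝ) ^ 3 / 2 - (downCount σ : ℝ) with hM
    have hwin := sector_window L hL3 hμ'abs hvmem hS3 hv0
    have hj : downCount σ ≤ L ^ 3 := by
      have h1 : downCount σ ≤ Fintype.card (TorusSite 3 L) := Finset.card_filter_le _ _ |>.trans
        (by rw [Finset.card_univ])
      have h2 : Fintype.card (TorusSite 3 L) = L ^ 3 := by simp [ZMod.card, Fintype.card_fin]
      omega
    have hMeq : ((L ^ 3 - downCount σ : ℕ) : ℝ) - (L : ℝ) ^ 3 / 2 = M := by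
      rw [Nat.cast_sub hj]
      push_cast
      rw [hM]
      ring
    refine ⟨L ^ 3 - downCount σ, ?_, ?_, ?_, ?_⟩
    · rw [Nat.cast_sub hj]
      push_cast
      rw [abs_le] at hwin
      obtain ⟨h1, h2⟩ := hwin
      rw [hVdef]
      linarith
    · rw [Nat.cast_sub hj]
      push_cast
      rw [abs_le] at hwin
      obtain ⟨h1, h2⟩ := hwin
      rw [hVdef]
      linarith
    · rw [hMeq]
      exact hS3
    · rw [hMeq]
      exact stub_sectorGround L μ' M v hvmem hS3 hv0
  -- the anchor at `μ = 0`: half filled (GroundSectorUnique) and a sector ground vector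
  obtain ⟨σ', hσ'0, hσ'⟩ := hanchor k hk₀
  set v' := (Hmu L 0).groundProj.col σ' with hv'def
  obtain ⟨hv'mem, -⟩ := col_facts L hL3 0 σ'
  have hS' : (totalSpin 1 2 : Op (TorusSite 3 L) 2) *ᵥ v' = ((0 : ℝ) : ℂ) • v' := by
    rw [Complex.ofReal_zero, zero_smul]
    exact groundSector_zero L hL4 hEven v' hv'mem
  have hH' : xyTorus 3 L 1 *ᵥ v' = ((lowestEnergyInSector 1 (xyTorus 3 L 1) 0 : ℝ) : ℂ) • v' :=
    stub_sectorGround L 0 0 v' hv'mem hS' hσ'0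
  have n'pos := normSq_pos_of_ne_zero hσ'0
  have hcast : (((2 * k : ℕ) : ℝ) ^ 3) = V := by rw [hVdef]
  rw [hcast] at hσ'
  have hratio' : a₀ * V ^ 2 ≤ (star v' ⬝ᵥ O *ᵥ v').re / (star v' ⬝ᵥ v').re := by
    rw [le_div_iff₀ n'pos]
    exact hσ'
  -- the k-th term
  show c' ≤ f k
  rw [hf]
  simp only []
  rw [orderParam_eq_re_gsf μ hk2]
  rw [le_div_iff₀ (by positivity)]
  rw [hcast]
  refine stub_average (Hmu_isHermitian L μ) O (c' * V ^ 2) fun σ hσ0 => ?_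
  obtain ⟨N, hNlo, hNhi, hS, hH⟩ := hcol μ hμ' σ hσ0
  set v := (Hmu L μ).groundProj.col σ with hvdef
  have npos := normSq_pos_of_ne_zero hσ0
  have h64 : (64 : ℝ) ≤ V := by
    have h4 : (4 : ℝ) ≤ (L : ℝ) := by exact_mod_cast hL4
    have h := pow_le_pow_left₀ (by norm_num) h4 3
    rw [hVdef]
    norm_num at h ⊢
    exact h
  have hN1 : 1 ≤ N := by
    have : (1 : ℝ) ≤ N := by linarith
    exact_mod_cast this
  have hN2 : N + 1 ≤ L ^ 3 := by
    have h45 : (N : ℝ) + 1 ≤ V := by linarith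
    rw [hVdef] at h45
    exact_mod_cast h45
  have key := hmono L hkL₁ hEven N hN1 hN2 v v' hσ0 hS hH hσ'0 hS' hH'
  -- the mean-field profile on the window: `4N(V−N)/V² ≥ 16/25`
  have hprof : (16 / 25 : ℝ) ≤ 4 * (N : ℝ) * ((L : ℝ) ^ 3 - N) / ((L : ℝ) ^ 3) ^ 2 := by
    rw [← hVdef, le_div_iff₀ (by positivity)]
    nlinarith [hNlo, hNhi, hVpos, mul_nonneg (sub_nonneg.2 hNlo) (sub_nonneg.2 hNhi)]
  have hprof1 : 4 * (N : ℝ) * ((L : ℝ) ^ 3 - N) / ((L : ℝ) ^ 3) ^ 2 ≤ 1 := by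
    rw [← hVdef, div_le_one (by positivity)]
    nlinarith [hNlo, hNhi, hVpos, sq_nonneg (V - 2 * N)]
  -- the anchor's coherence: `a(v') − V/2 ≥ a₀V² − V/2 ≥ a₀V²/2`
  have hanc : a₀ * V ^ 2 / 2 ≤ (star v' ⬝ᵥ O *ᵥ v').re / (star v' ⬝ᵥ v').re - (L : ℝ) ^ 3 / 2 := by
    rw [← hVdef]
    linarith
  have hratio : (star v ⬝ᵥ O *ᵥ v).re / (star v ⬝ᵥ v).re * (star v ⬝ᵥ v).re =
      (star v ⬝ᵥ O *ᵥ v).re := div_mul_cancel₀ _ npos.ne'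
  have hmain : c' * V ^ 2 ≤ (star v ⬝ᵥ O *ᵥ v).re / (star v ⬝ᵥ v).re := by
    have h1 : a₀ * V ^ 2 / 2 * (16 / 25) ≤
        ((star v' ⬝ᵥ O *ᵥ v').re / (star v' ⬝ᵥ v').re - (L : ℝ) ^ 3 / 2) *
          (4 * (N : ℝ) * ((L : ℝ) ^ 3 - N) / ((L : ℝ) ^ 3) ^ 2) :=
      mul_le_mul hanc hprof (by norm_num) (by linarith [hanc, ha₀, hVpos])
    have h2 : (0 : ℝ) ≤ (L : ℝ) ^ 3 / 2 := by positivity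
    rw [hc']
    linarith [key, h1, h2]
  calc c' * V ^ 2 * (star v ⬝ᵥ v).re
      ≤ (star v ⬝ᵥ O *ᵥ v).re / (star v ⬝ᵥ v).re * (star v ⬝ᵥ v).re :=
        mul_le_mul_of_nonneg_right hmain npos.le
    _ = (star v ⬝ᵥ O *ᵥ v).re := hratio

end Summit.AtomisticToContinuum.BoseEinsteinCondensation.Theorems.LatticeODLROOffHalfFilling.Ladder

end
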